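/-
Copyright (c) 2026. Released under the Apache 2.0 license.
-/
import Literature.NumberTheory.EllipticCurves.ManinConstantQuadraticTwistCremonaRangeProofs
import HarnessLib

/-!
# A seventh source of `ClassAbsManinConstantEqOne W`: ONE odd prime of Kodaira type `Iₙ*` (or a
# displayed twist witness) whose twist partner lies in Cremona's PRINTED range `N' ≤ 130000` — the
# named predicate of the twist-descent road of `ManinConstantQuadraticTwistCremonaRangeProofs.lean`

This small file NAMES the hypothesis of the kernel theorem
`classAbsManinConstantEqOne_of_forall_exists_kodairaIstar_or_twist_of_level_le`
(`ManinConstantQuadraticTwistCremonaRangeProofs.lean`) as a class predicate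
`IsTwistCremonaRangeCovered W`, in the format of the tree's earlier class certificates
(`IsMazurCesnaviciusCovered`, `IsEdixhovenCesnaviciusCovered`, `IsEdixhovenCesnaviciusTwistCovered`,
`IsEdixhovenKodairaTwistCovered`): EVERY globally minimal member `W'` of the isogeny class of `W` has
SOME odd prime `p` with ONE of

* the Kodaira symbol of `W'` at `p` is `I₀*` and `N(W') ≤ 130000·p²` (the twist `W' ⊗ χ_{p*}` has
  good reduction at `p`, partner conductor `N(W')/p²`);
* the Kodaira symbol of `W'` at `p` is `I_ν*` for some `ν ≥ 1` and `N(W') ≤ 130000·p` (the twist is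
  multiplicative at `p`, partner conductor `N(W')/p`);
* a displayed twist witness `TwistSemistableWitnessAt W' p` (`ManinConstantClassCertificateTwist.lean`)
  and `N(W') ≤ 130000·p` (its clause `N(V)·p ∣ N(W')` gives `N(V) ≤ 130000`).

In each case the optimal curve of the partner class has Manin constant `±1` by Agashe–Ribet–Stein
2006, Thm. 2.6 (Cremona: "If `E` is an optimal elliptic curve over `ℚ` with conductor at most
`130000`, then `c_E = 1`"; the tree's named fact
`AgasheRibetStein2006.cremona_abs_maninConstant_eq_one_of_level_le`), and the `Γ₀` twist step
`c₀(𝒜) ∣ c(D')` (`maninConstant_dvd_of_charTwist_gamma0`) transports `|c| = 1` to the class of `W` —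
at ALL primes at once, whatever the other primes of `N(W)` are. Unlike the per-prime certificates,
no condition is imposed at the other square primes of the conductor. Binders of the constructor:
`h26` (Agashe–Ribet–Stein 2006 Thm. 2.6) and `hnf` (modularity) ONLY.
Definitions and their unfolding lemmas only; the constructor is one line from the proofs file.

## References
* [AgasheRibetStein2006] A. Agashe, K. Ribet, W. A. Stein, *The Manin constant*, with an appendix
  by J. Cremona, Pure Appl. Math. Q. 2 (2006) 617–636: Thm. 2.6 (p. 619), appendix Thm. 5.2 (p. 633).
* [Stevens1989] G. Stevens, Invent. Math. 98 (1989), Lemmas (5.2), (5.4).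
* [SilvermanATAEC1994] J. H. Silverman, *ATAEC*, IV.9 Table 4.1 and IV.11.1 table p. 368.
* [EdixhovenManin1991] B. Edixhoven, Progr. Math. 89 (1991), §1.
-/

noncomputable section

open scoped MatrixGroups ModularForm

open CongruenceSubgroup WeierstrassCurve

namespace Literature.NumberTheory.EllipticCurves.ModularForms

/-- **The "twist–Cremona-range covered" classes**: every globally minimal member `W'` of the class
of `W` has an odd prime `p` at which EITHER the Kodaira symbol of `W'` (Tate's algorithm at the
place `(p)` of `ℤ`, `WeierstrassCurve.kodairaSymbolAt`) is `I₀*` and `N(W') ≤ 130000·p²`, OR it is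
`I_ν*` for some `ν ≥ 1` and `N(W') ≤ 130000·p`, OR a twist witness `TwistSemistableWitnessAt W' p`
is displayed and `N(W') ≤ 130000·p` — so that the class is the `χ_{p*}`-twist of a class
semistable at `p` whose conductor is at most `130000`, the range of Agashe–Ribet–Stein 2006
Thm. 2.6 (Cremona). A predicate; nothing asserted.
[cite: AgasheRibetStein2006, Thm. 2.6 (p. 619)] [cite: SilvermanATAEC1994, IV.11.1 table p. 368]
[cite: Stevens1989, Lemmas (5.2), (5.4)] -/
def IsTwistCremonaRangeCovered (W : WeierstrassCurve ℚ) : Prop :=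
  ∀ (W' : WeierstrassCurve ℚ) [W'.IsElliptic] [W'.IsGloballyMinimal], IsIsogenous W W' →
    ∃ (p : ℕ) (hp : p.Prime), p ≠ 2 ∧
      ((W'.kodairaSymbolAt ((Rat.HeightOneSpectrum.primesEquiv (R := ℤ)).symm ⟨p, hp⟩) = .Istar 0 ∧
          W'.conductorNorm ℤ ≤ 130000 * p ^ 2) ∨
       ((∃ n : ℕ,
          W'.kodairaSymbolAt ((Rat.HeightOneSpectrum.primesEquiv (R := ℤ)).symm ⟨p, hp⟩) =
            .Istar (n + 1)) ∧ W'.conductorNorm ℤ ≤ 130000 * p) ∨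
       (@TwistSemistableWitnessAt W' p ⟨hp⟩ ∧ W'.conductorNorm ℤ ≤ 130000 * p))

/-- Unfolding of `IsTwistCremonaRangeCovered` (by `Iff.rfl`).
[cite: AgasheRibetStein2006, Thm. 2.6] -/
theorem isTwistCremonaRangeCovered_iff (W : WeierstrassCurve ℚ) :
    IsTwistCremonaRangeCovered W ↔
      ∀ (W' : WeierstrassCurve ℚ) [W'.IsElliptic] [W'.IsGloballyMinimal], IsIsogenous W W' →
        ∃ (p : ℕ) (hp : p.Prime), p ≠ 2 ∧
          ((W'.kodairaSymbolAt ((Rat.HeightOneSpectrum.primesEquiv (R := ℤ)).symm ⟨p, hp⟩) =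
                .Istar 0 ∧ W'.conductorNorm ℤ ≤ 130000 * p ^ 2) ∨
           ((∃ n : ℕ,
              W'.kodairaSymbolAt ((Rat.HeightOneSpectrum.primesEquiv (R := ℤ)).symm ⟨p, hp⟩) =
                .Istar (n + 1)) ∧ W'.conductorNorm ℤ ≤ 130000 * p) ∨
           (@TwistSemistableWitnessAt W' p ⟨hp⟩ ∧ W'.conductorNorm ℤ ≤ 130000 * p)) :=
  Iff.rfl

/-- A class all of whose globally minimal members have an odd prime of Kodaira type `Iₙ*` (some
`n ≥ 0`) with the uniform level bound `N(W') ≤ 130000·p` is twist–Cremona-range covered (first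
or second disjunct; `130000·p ≤ 130000·p²`). [cite: SilvermanATAEC1994, IV.11.1 table p. 368]
[cite: AgasheRibetStein2006, Thm. 2.6] -/
theorem isTwistCremonaRangeCovered_of_forall_exists_kodairaIstar {W : WeierstrassCurve ℚ}
    (h : ∀ (W' : WeierstrassCurve ℚ) [W'.IsElliptic] [W'.IsGloballyMinimal], IsIsogenous W W' →
      ∃ (p : ℕ) (hp : p.Prime), p ≠ 2 ∧
        (∃ n : ℕ,
          W'.kodairaSymbolAt ((Rat.HeightOneSpectrum.primesEquiv (R := ℤ)).symm ⟨p, hp⟩) = .Istar n) ∧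
          W'.conductorNorm ℤ ≤ 130000 * p) :
    IsTwistCremonaRangeCovered W := by
  intro W' _ _ hiso
  obtain ⟨p, hp, hp2, ⟨n, hK⟩, hlev⟩ := h W' hiso
  refine ⟨p, hp, hp2, ?_⟩
  cases n with
  | zero =>
    refine Or.inl ⟨hK, hlev.trans ?_⟩
    have : p ≤ p ^ 2 := by rw [pow_two]; exact Nat.le_mul_of_pos_left p hp.pos
    exact Nat.mul_le_mul_left 130000 this
  | succ n => exact Or.inr (Or.inl ⟨⟨n, hK⟩, hlev⟩)

/-- A class all of whose globally minimal members carry a displayed twist witness at an odd prime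
`p` with `N(W') ≤ 130000·p` is twist–Cremona-range covered (third disjunct).
[cite: Stevens1989, Lemmas (5.2), (5.4)] [cite: AgasheRibetStein2006, Thm. 2.6] -/
theorem isTwistCremonaRangeCovered_of_forall_exists_twistSemistableWitnessAt {W : WeierstrassCurve ℚ}
    (h : ∀ (W' : WeierstrassCurve ℚ) [W'.IsElliptic] [W'.IsGloballyMinimal], IsIsogenous W W' →
      ∃ (p : ℕ) (hp : p.Prime), @TwistSemistableWitnessAt W' p ⟨hp⟩ ∧
        W'.conductorNorm ℤ ≤ 130000 * p) :
    IsTwistCremonaRangeCovered W := by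
  intro W' _ _ hiso
  obtain ⟨p, hp, htw, hlev⟩ := h W' hiso
  exact ⟨p, hp, htw.1, Or.inr (Or.inr ⟨htw, hlev⟩)⟩

/-- **The class certificate BY NAME — twist-descent into Cremona's printed range, binders `h26 hnf`**:
`IsTwistCremonaRangeCovered W → ClassAbsManinConstantEqOne W`; the kernel theorem
`classAbsManinConstantEqOne_of_forall_exists_kodairaIstar_or_twist_of_level_le` under its named
hypothesis. [cite: AgasheRibetStein2006, Thm. 2.6 (p. 619) and appendix Thm. 5.2 (p. 633)]
[cite: Stevens1989, Lemmas (5.2), (5.4)] [cite: SilvermanATAEC1994, IV.11.1 table p. 368] -/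
theorem classAbsManinConstantEqOne_of_isTwistCremonaRangeCovered
    (h26 : AgasheRibetStein2006.cremona_abs_maninConstant_eq_one_of_level_le)
    (hnf : exists_isNewformOf)
    (W : WeierstrassCurve ℚ) (hcov : IsTwistCremonaRangeCovered W) :
    ClassAbsManinConstantEqOne W :=
  classAbsManinConstantEqOne_of_forall_exists_kodairaIstar_or_twist_of_level_le h26 hnf W hcov

/-- The binder form carried by consumers: for a twist–Cremona-range covered class, `p ∤ c` for
EVERY prime `p` and every lattice-optimal `X₀`-datum of every globally minimal member, modulo
`h26 hnf`. [cite: AgasheRibetStein2006, Thm. 2.6] [cite: Stevens1989, Lemmas (5.2), (5.4)] -/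
theorem not_dvd_maninConstant_of_isTwistCremonaRangeCovered
    (h26 : AgasheRibetStein2006.cremona_abs_maninConstant_eq_one_of_level_le)
    (hnf : exists_isNewformOf)
    {W : WeierstrassCurve ℚ} (hcov : IsTwistCremonaRangeCovered W)
    (W' : WeierstrassCurve ℚ) [W'.IsElliptic] [W'.IsGloballyMinimal] {N' : ℕ} [NeZero N']
    (D' : ModularParametrizationData W' N') (hiso : IsIsogenous W W')
    (hopt : ∀ z ∈ D'.L.lattice, ∃ w ∈ periodLattice D'.f, z = D'.c * w)
    (p : ℕ) (hp : p.Prime) : ¬ (p : ℤ) ∣ D'.maninConstant :=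
  (classAbsManinConstantEqOne_of_isTwistCremonaRangeCovered h26 hnf W hcov).not_dvd_maninConstant
    D' hiso hopt hp

/-- The valuation form (`ord_p c = 0`, the record-side binder shape).
[cite: AgasheRibetStein2006, Thm. 2.6] -/
theorem padicValInt_maninConstant_eq_zero_of_isTwistCremonaRangeCovered
    (h26 : AgasheRibetStein2006.cremona_abs_maninConstant_eq_one_of_level_le)
    (hnf : exists_isNewformOf)
    {W : WeierstrassCurve ℚ} (hcov : IsTwistCremonaRangeCovered W)
    (W' : WeierstrassCurve ℚ) [W'.IsElliptic] [W'.IsGloballyMinimal] {N' : ℕ} [NeZero N']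
    (D' : ModularParametrizationData W' N') (hiso : IsIsogenous W W')
    (hopt : ∀ z ∈ D'.L.lattice, ∃ w ∈ periodLattice D'.f, z = D'.c * w)
    (p : ℕ) [hp : Fact p.Prime] : padicValInt p D'.maninConstant = 0 :=
  (classAbsManinConstantEqOne_of_isTwistCremonaRangeCovered h26 hnf W
    hcov).padicValInt_maninConstant_eq_zero D' hiso hopt p

end Literature.NumberTheory.EllipticCurves.ModularForms

end
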